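import Mathlib

/-!
# `OverbindingBudget` / crux `RobustDefectLimitWindows` (stmt-AtomisticToContinuum-31280) — «RunCut»: the pointwise DEFORMATION INEQUALITIES of
the chirality line

Support file (lens-4 g87, hand-in 3; memo `g87/memo/SW-CHI.md` §2; owed since critic row 1556 (A): «g87 supplies (a) the pointwise deformation
inequalities `|rᵀGr| ≤ τ|r|²`, `|(rᵀGr)² − 4(rᵀEr)²| ≤ σ|r|⁴` from the AffFramed witness»).

A pair potential in the squared distance, `V(|ρ|) = W(|ρ|²)`, sees an affine deformation `ρ = (1 + C)r` of a bond `r` only through the METRIC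
DEFORMATION `t(r) = |(1 + C)r|² − |r|² = 2·rᵀCr + |Cr|²` (`strainT`; `rᵀCr = rᵀEr` for the symmetric part `E` of `C` — `quadForm`; `|Cr|²` —
`defSq`).  From ONE scalar datum, a Frobenius bound `Σ C_ij² ≤ η²` (in the application `η² = (3/2)θ₀²`, the second-shell moment identity of
`…RunCutChiralityCap.sum_sq_le_of_shell`), Cauchy–Schwarz gives, for EVERY bond `r`,
  `|rᵀCr| ≤ η|r|²`, `|Cr|² ≤ η²|r|²`, hence ★ `|t(r)| ≤ (2η + η²)|r|²` and ★ `|t(r)² − 4(rᵀCr)²| ≤ (4η³ + η⁴)|r|⁴`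
(`t² − 4u² = (4u + m)m`, `u = rᵀCr`, `m = |Cr|²`) — the two hypotheses of `…RunCutChiralityRemainder.coset_remainder_le` with `τ = 2η + η²`,
`σ = 4η³ + η⁴`.  The CLASS PARTNER of a bilayer bond `r = (x, y, h)` is `r̄ = (−x, −y, h)` (same length); the file also records the polynomial
forms of `rᵀCr`, `r̄ᵀCr̄` (the two quadratic forms of `…RunCutChiralitySelect.tsum_weight_quadForm_sq_sub`) and the first-order class
difference `t(r) − t(r̄) = x·λ₁ + y·λ₂` (LINEAR in the in-plane coordinates, so it is killed by the first moments).
[this file: 5 definitions (`quadForm`, `defSq`, `normSq3`, `strainT`, `classBar`), 16 theorems; Mathlib only; standard axioms]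
-/

namespace Summit.AtomisticToContinuum.Crystallization.Theorems.OverbindingBudgetAffineRunCutChiralityDeform

open Finset Matrix

/-! ## §1. The three quadratic quantities of a deformed bond -/

/-- `rᵀ C r = Σ_ij C_ij r_i r_j` (only the symmetric part of `C` enters). [this file · kind: definition] -/
def quadForm (C : Matrix (Fin 3) (Fin 3) ℝ) (r : Fin 3 → ℝ) : ℝ :=
  ∑ i, ∑ j, C i j * (r i * r j)

/-- `|C r|² = Σ_i (Σ_j C_ij r_j)²`. [this file · kind: definition] -/
def defSq (C : Matrix (Fin 3) (Fin 3) ℝ) (r : Fin 3 → ℝ) : ℝ :=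
  ∑ i, (∑ j, C i j * r j) ^ 2

/-- `|r|² = Σ_i r_i²`. [this file · kind: definition] -/
def normSq3 (r : Fin 3 → ℝ) : ℝ :=
  ∑ i, r i ^ 2

/-- **The metric deformation** `t(r) = 2·rᵀCr + |Cr|²` (`= |(1+C)r|² − |r|²`, `strainT_eq`). [this file · kind: definition] -/
def strainT (C : Matrix (Fin 3) (Fin 3) ℝ) (r : Fin 3 → ℝ) : ℝ :=
  2 * quadForm C r + defSq C r

/-- **The class partner** of a bilayer bond: `(x, y, h) ↦ (−x, −y, h)`. [this file · kind: definition] -/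
def classBar (r : Fin 3 → ℝ) : Fin 3 → ℝ :=
  ![-r 0, -r 1, r 2]

/-- ★ **DICTIONARY**: `t(r) = |(1 + C) r|² − |r|²` — the squared deformed bond length is `|r|² + t(r)`. [this file · kind: proof] -/
theorem strainT_eq (C : Matrix (Fin 3) (Fin 3) ℝ) (r : Fin 3 → ℝ) :
    strainT C r = (∑ i, (r i + ∑ j, C i j * r j) ^ 2) - normSq3 r := by
  simp only [strainT, quadForm, defSq, normSq3, Fin.sum_univ_three]
  ring

/-- The same with `Matrix.mulVec`: `|r|² + t(r) = Σ_i ((1 + C) *ᵥ r)_i²`. [this file · kind: proof] -/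
theorem normSq3_add_strainT (C : Matrix (Fin 3) (Fin 3) ℝ) (r : Fin 3 → ℝ) :
    normSq3 r + strainT C r = ∑ i, ((1 + C) *ᵥ r) i ^ 2 := by
  rw [strainT_eq]
  have h : ∀ i, ((1 + C) *ᵥ r) i = r i + ∑ j, C i j * r j := by
    intro i
    rw [Matrix.add_mulVec, Matrix.one_mulVec, Pi.add_apply]
    rfl
  simp only [h]
  ring

/-- `rᵀCr = Σ_i r_i (Cr)_i`. [folklore] -/
theorem quadForm_eq_sum_mul (C : Matrix (Fin 3) (Fin 3) ℝ) (r : Fin 3 → ℝ) :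
    quadForm C r = ∑ i, r i * ∑ j, C i j * r j := by
  unfold quadForm
  refine Finset.sum_congr rfl fun i _ => ?_
  rw [Finset.mul_sum]
  exact Finset.sum_congr rfl fun j _ => by ring

/-! ## §2. Cauchy–Schwarz against the Frobenius norm -/

/-- `|Cr|² ≤ ‖C‖²_F·|r|²` (row-wise Cauchy–Schwarz). [folklore] -/
theorem defSq_le (C : Matrix (Fin 3) (Fin 3) ℝ) (r : Fin 3 → ℝ) :
    defSq C r ≤ (∑ i, ∑ j, C i j ^ 2) * normSq3 r := by
  unfold defSq normSq3
  rw [Finset.sum_mul]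
  exact Finset.sum_le_sum fun i _ => Finset.sum_mul_sq_le_sq_mul_sq Finset.univ (fun j => C i j) r

/-- `(rᵀCr)² ≤ ‖C‖²_F·|r|⁴`. [folklore] -/
theorem quadForm_sq_le (C : Matrix (Fin 3) (Fin 3) ℝ) (r : Fin 3 → ℝ) :
    quadForm C r ^ 2 ≤ (∑ i, ∑ j, C i j ^ 2) * normSq3 r ^ 2 := by
  rw [quadForm_eq_sum_mul]
  have h1 := Finset.sum_mul_sq_le_sq_mul_sq Finset.univ r (fun i => ∑ j, C i j * r j)
  have h2 := defSq_le C r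
  unfold defSq at h2
  have hR : 0 ≤ normSq3 r := Finset.sum_nonneg fun i _ => sq_nonneg (r i)
  unfold normSq3 at hR h2 ⊢
  calc (∑ i, r i * ∑ j, C i j * r j) ^ 2 ≤ (∑ i, r i ^ 2) * ∑ i, (∑ j, C i j * r j) ^ 2 := h1
    _ ≤ (∑ i, r i ^ 2) * ((∑ i, ∑ j, C i j ^ 2) * ∑ i, r i ^ 2) := mul_le_mul_of_nonneg_left h2 hR
    _ = _ := by ring

/-- `|r|² ≥ 0`. [folklore] -/
theorem normSq3_nonneg (r : Fin 3 → ℝ) : 0 ≤ normSq3 r :=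
  Finset.sum_nonneg fun i _ => sq_nonneg (r i)

/-- ★ `Σ C_ij² ≤ η²` (`η ≥ 0`) ⇒ `|rᵀCr| ≤ η·|r|²`. [this file · kind: proof] -/
theorem abs_quadForm_le {C : Matrix (Fin 3) (Fin 3) ℝ} {η : ℝ} (hη : 0 ≤ η) (hC : ∑ i, ∑ j, C i j ^ 2 ≤ η ^ 2)
    (r : Fin 3 → ℝ) : |quadForm C r| ≤ η * normSq3 r := by
  have hR := normSq3_nonneg r
  refine abs_le_of_sq_le_sq ?_ (mul_nonneg hη hR)
  calc quadForm C r ^ 2 ≤ (∑ i, ∑ j, C i j ^ 2) * normSq3 r ^ 2 := quadForm_sq_le C r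
    _ ≤ η ^ 2 * normSq3 r ^ 2 := mul_le_mul_of_nonneg_right hC (sq_nonneg _)
    _ = (η * normSq3 r) ^ 2 := by ring

/-- ★ `Σ C_ij² ≤ η²` ⇒ `|Cr|² ≤ η²·|r|²`. [this file · kind: proof] -/
theorem defSq_le_of_frob {C : Matrix (Fin 3) (Fin 3) ℝ} {η : ℝ} (hC : ∑ i, ∑ j, C i j ^ 2 ≤ η ^ 2) (r : Fin 3 → ℝ) :
    defSq C r ≤ η ^ 2 * normSq3 r :=
  (defSq_le C r).trans (mul_le_mul_of_nonneg_right hC (normSq3_nonneg r))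

/-- ★ **`|t(r)| ≤ (2η + η²)·|r|²`** — the `τ`-hypothesis of `coset_remainder_le` with `τ = 2η + η²`. [this file · kind: proof] -/
theorem abs_strainT_le {C : Matrix (Fin 3) (Fin 3) ℝ} {η : ℝ} (hη : 0 ≤ η) (hC : ∑ i, ∑ j, C i j ^ 2 ≤ η ^ 2) (r : Fin 3 → ℝ) :
    |strainT C r| ≤ (2 * η + η ^ 2) * normSq3 r := by
  have hu := abs_quadForm_le hη hC r
  have hm := defSq_le_of_frob hC r
  have hm0 : 0 ≤ defSq C r := Finset.sum_nonneg fun i _ => sq_nonneg _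
  have h2 : 0 ≤ η ^ 2 * normSq3 r := mul_nonneg (sq_nonneg η) (normSq3_nonneg r)
  unfold strainT
  rw [abs_le] at hu ⊢
  constructor <;> linarith [hu.1, hu.2]

/-- ★ **`|t(r)² − 4(rᵀCr)²| ≤ (4η³ + η⁴)·|r|⁴`** (`t² − 4u² = (4u + m)·m`) — the `σ`-hypothesis of `coset_remainder_le` with
`σ = 4η³ + η⁴`. [this file · kind: proof] -/
theorem abs_strainT_sq_sub_le {C : Matrix (Fin 3) (Fin 3) ℝ} {η : ℝ} (hη : 0 ≤ η) (hC : ∑ i, ∑ j, C i j ^ 2 ≤ η ^ 2)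
    (r : Fin 3 → ℝ) : |strainT C r ^ 2 - 4 * quadForm C r ^ 2| ≤ (4 * η ^ 3 + η ^ 4) * normSq3 r ^ 2 := by
  have hu := abs_quadForm_le hη hC r
  have hm := defSq_le_of_frob hC r
  have hm0 : 0 ≤ defSq C r := Finset.sum_nonneg fun i _ => sq_nonneg _
  have hR := normSq3_nonneg r
  have e : strainT C r ^ 2 - 4 * quadForm C r ^ 2 = (4 * quadForm C r + defSq C r) * defSq C r := by
    unfold strainT; ring
  rw [e, abs_mul, abs_of_nonneg hm0]
  have h1 : |4 * quadForm C r + defSq C r| ≤ 4 * (η * normSq3 r) + η ^ 2 * normSq3 r := by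
    calc |4 * quadForm C r + defSq C r| ≤ |4 * quadForm C r| + |defSq C r| := abs_add_le _ _
      _ = 4 * |quadForm C r| + defSq C r := by rw [abs_mul, abs_of_nonneg hm0]; norm_num
      _ ≤ _ := by linarith
  calc |4 * quadForm C r + defSq C r| * defSq C r
      ≤ (4 * (η * normSq3 r) + η ^ 2 * normSq3 r) * (η ^ 2 * normSq3 r) :=
        mul_le_mul h1 hm hm0 (by positivity)
    _ = (4 * η ^ 3 + η ^ 4) * normSq3 r ^ 2 := by ring

/-! ## §3. The bilayer bond `(x, y, h)` and its class partner `(−x, −y, h)` -/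

/-- Same length: `|r̄|² = |r|²`. [folklore] -/
theorem normSq3_classBar (r : Fin 3 → ℝ) : normSq3 (classBar r) = normSq3 r := by
  simp only [normSq3, classBar, Fin.sum_univ_three, Matrix.cons_val_zero, Matrix.cons_val_one, Matrix.head_cons,
    Matrix.cons_val_two, Matrix.tail_cons]
  ring

/-- `|(x, y, h)|² = x² + y² + h²`. [folklore] -/
theorem normSq3_vec3 (x y h : ℝ) : normSq3 ![x, y, h] = x ^ 2 + y ^ 2 + h ^ 2 := by
  simp only [normSq3, Fin.sum_univ_three, Matrix.cons_val_zero, Matrix.cons_val_one, Matrix.head_cons, Matrix.cons_val_two,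
    Matrix.tail_cons]

/-- The class partner of `(x, y, h)` is `(−x, −y, h)`. [folklore] -/
theorem classBar_vec3 (x y h : ℝ) : classBar ![x, y, h] = ![-x, -y, h] := by
  simp only [classBar, Matrix.cons_val_zero, Matrix.cons_val_one, Matrix.head_cons, Matrix.cons_val_two, Matrix.tail_cons]

/-- **Polynomial form of `rᵀCr`** on `r = (x, y, h)` — the first quadratic form of `tsum_weight_quadForm_sq_sub` with the symmetrised entries
`e₁₂ = (C₀₁ + C₁₀)/2`, `e₁₃ = (C₀₂ + C₂₀)/2`, `e₂₃ = (C₁₂ + C₂₁)/2`. [this file · kind: proof] -/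
theorem quadForm_vec3 (C : Matrix (Fin 3) (Fin 3) ℝ) (x y h : ℝ) :
    quadForm C ![x, y, h] = C 0 0 * x ^ 2 + C 1 1 * y ^ 2 + C 2 2 * h ^ 2 + 2 * ((C 0 1 + C 1 0) / 2) * (x * y)
      + 2 * ((C 0 2 + C 2 0) / 2) * (x * h) + 2 * ((C 1 2 + C 2 1) / 2) * (y * h) := by
  simp only [quadForm, Fin.sum_univ_three, Matrix.cons_val_zero, Matrix.cons_val_one, Matrix.head_cons, Matrix.cons_val_two,
    Matrix.tail_cons]
  ring

/-- **Polynomial form of `r̄ᵀCr̄`** on the class partner `(−x, −y, h)` — the second quadratic form of `tsum_weight_quadForm_sq_sub`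
(the `xh`, `yh` cross terms change sign). [this file · kind: proof] -/
theorem quadForm_classBar_vec3 (C : Matrix (Fin 3) (Fin 3) ℝ) (x y h : ℝ) :
    quadForm C (classBar ![x, y, h]) = C 0 0 * x ^ 2 + C 1 1 * y ^ 2 + C 2 2 * h ^ 2 + 2 * ((C 0 1 + C 1 0) / 2) * (x * y)
      - 2 * ((C 0 2 + C 2 0) / 2) * (x * h) - 2 * ((C 1 2 + C 2 1) / 2) * (y * h) := by
  rw [classBar_vec3]
  simp only [quadForm, Fin.sum_univ_three, Matrix.cons_val_zero, Matrix.cons_val_one, Matrix.head_cons, Matrix.cons_val_two,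
    Matrix.tail_cons]
  ring

/-- ★ **The first-order class difference is LINEAR in the in-plane coordinates**:
`t(x,y,h) − t(−x,−y,h) = x·(4h·((C₀₂ + C₂₀) + Σ_i C_i0 C_i2)) + y·(4h·((C₁₂ + C₂₁) + Σ_i C_i1 C_i2))` — so over a `C₃`-symmetric coset
its weighted sum vanishes by the first-moment identities (`…RunCutChiralityMoments.odd_moments_metric`). [this file · kind: proof] -/
theorem strainT_sub_classBar_vec3 (C : Matrix (Fin 3) (Fin 3) ℝ) (x y h : ℝ) :
    strainT C ![x, y, h] - strainT C (classBar ![x, y, h])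
      = x * (4 * h * ((C 0 2 + C 2 0) + ∑ i, C i 0 * C i 2)) + y * (4 * h * ((C 1 2 + C 2 1) + ∑ i, C i 1 * C i 2)) := by
  rw [classBar_vec3]
  simp only [strainT, quadForm, defSq, Fin.sum_univ_three, Matrix.cons_val_zero, Matrix.cons_val_one, Matrix.head_cons,
    Matrix.cons_val_two, Matrix.tail_cons]
  ring

end Summit.AtomisticToContinuum.Crystallization.Theorems.OverbindingBudgetAffineRunCutChiralityDeform
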